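import Mathlib.Analysis.SpecialFunctions.BinaryEntropy
import Literature.InformationTheory.Entropy.MapEntropy

/-!
# PneNP / SzkEntropy — crux `PeaThreeNotInP` (stmt-PneNP-10776), negative side: the masked-uniform gadget (entropy is affine in an acceptance probability)

Route `PneNP/SzkEntropy`, crux X = `PeaThreeNotInP` (`PEA 3 ∉ PromiseP`).  First brick of the
DISPROOF-PRICE rider `¬X → CAPP_BDD ∈ prP` (a refutation of X yields deterministic approximate
counting for branching programs, hence [Williams 2013; Chen–Lyu–Williams 2020] breakthrough circuit
lower bounds): the entropy gadget that turns an ACCEPTANCE PROBABILITY into an ENTROPY threshold with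
integer arithmetic only (no logarithm enclosures).

For `g : α → Bool` on a finite uniform sample space, `p := P[g = 1] = #{g = 1}/|α|`, and `L` fresh
uniform bits `y ∈ F₂^L`, let `Z(x, y) := if g x then y else 0`.  Then

* `mapEntropy_joint_bounds` — the joint map `(x, y) ↦ (g x, Z(x, y))` has entropy in
  `[p·L, p·L + 1]` (exactly `h(p) + p·L`, `h` = binary entropy, `0 ≤ h ≤ 1` from Mathlib's
  `Real.binEntropy_nonneg` / `Real.binEntropy_le_log_two`); closed form `mapEntropy_joint_eq`;
* **`mapEntropy_masked_bounds` — `p·L − 1 ≤ H(Z) ≤ p·L + 1`** (forgetting the bit `g x` costs at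
  most one bit: tree lemma `mapEntropy_sub_le_mapEntropy_comp`; post-processing never gains:
  `mapEntropy_comp_le`).

Use (next bricks): with `g` = a branching program `B` and the tree's degree-3 AIK encoding of the
programs `B ∧ y_j` (`Literature/Computability/Cryptography/BranchingProgramEncoding.lean`,
`entropy_encodeBDDsMap`: `H = H(Z) + m` exactly), `L = 2^{e+3}` and the INTEGER threshold
`k = m + ⌈a·L⌉ + 3` separate `p ≥ a + 2^{-e}` (then `H ≥ k + 1`) from `p ≤ a` (then `H ≤ k`): one
`PEA 3` instance per `CAPP` instance, a Karp reduction, so `PEA 3 ∈ PromiseP` puts gap-`CAPP` for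
branching programs in promise-`P`.  No Theses decl is asserted here.

References: T. Cover, J. Thomas, *Elements of Information Theory*, 2nd ed., Thm 2.2.1, (2.5), (2.14),
Problem 2.4; R. Williams, *Improving exhaustive search implies superpolynomial lower bounds*, SIAM J.
Comput. 42 (2013), Thm 1.1; L. Chen, X. Lyu, R. Williams, FOCS 2020, Thm 1.2; Z. Dvir, D. Gutfreund,
G. N. Rothblum, S. Vadhan, ECCC TR10-160 (2010), Claim 4.4.
-/

namespace Summit.PneNP.PneNP.Theorems.PeaThreeNotInP.Negative

set_option linter.dupNamespace false -- `Summit.PneNP.PneNP.…`: summit = sub-problem name (D-0017 single-conjunct layout)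

open Finset Literature.InformationTheory.Entropy

variable {α : Type*} [Fintype α] (g : α → Bool) (L : ℕ)

/-- Fibres of the joint map `(x, y) ↦ (g x, Z(x,y))` through an accepted point: `{g = 1} × {y}`. -/
theorem card_fiber_joint_true (y : Fin L → ZMod 2) :
    (fiber (univ : Finset (α × (Fin L → ZMod 2)))
        (fun q => (g q.1, if g q.1 then q.2 else (0 : Fin L → ZMod 2))) (true, y)).card =
      (univ.filter fun x' : α => g x' = true).card := by
  rw [← Finset.card_map ⟨fun x' : α => (x', y), fun a b h => (Prod.ext_iff.1 h).1⟩]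
  congr 1
  ext ⟨x', y'⟩
  simp only [mem_fiber, mem_univ, true_and, Finset.mem_map, Finset.mem_filter,
    Function.Embedding.coeFn_mk, Prod.mk.injEq]
  constructor
  · intro h
    have hg : g x' = true := h.1
    refine ⟨x', hg, rfl, ?_⟩
    have := h.2
    rw [hg, if_pos rfl] at this
    exact this.symm
  · rintro ⟨a, ha, rfl, rfl⟩
    exact ⟨ha, by rw [ha, if_pos rfl]⟩

/-- Fibres through a rejected point: `{g = 0} × everything`. -/
theorem card_fiber_joint_false :
    (fiber (univ : Finset (α × (Fin L → ZMod 2)))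
        (fun q => (g q.1, if g q.1 then q.2 else (0 : Fin L → ZMod 2)))
        (false, (0 : Fin L → ZMod 2))).card =
      (univ.filter fun x' : α => g x' = false).card * 2 ^ L := by
  have : fiber (univ : Finset (α × (Fin L → ZMod 2)))
      (fun q => (g q.1, if g q.1 then q.2 else (0 : Fin L → ZMod 2))) (false, 0) =
      (univ.filter fun x' : α => g x' = false) ×ˢ (univ : Finset (Fin L → ZMod 2)) := by
    ext ⟨x', y'⟩
    simp only [mem_fiber, mem_univ, true_and, Finset.mem_product, Finset.mem_filter, and_true,
      Prod.mk.injEq]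
    constructor
    · intro h; exact h.1
    · intro h; exact ⟨h, by rw [h, if_neg (by decide)]⟩
  rw [this, Finset.card_product, Finset.card_univ, Fintype.card_pi, Finset.prod_const, ZMod.card,
    Finset.card_univ, Fintype.card_fin]

/-- The summand of `mapEntropy` for the joint map is one of two constants, according to `g x`. -/
theorem logb_fiber_joint [Nonempty α] (q : α × (Fin L → ZMod 2)) :
    Real.logb 2 ((((univ : Finset (α × (Fin L → ZMod 2))).card : ℕ) : ℝ) /
        (fiber (univ : Finset (α × (Fin L → ZMod 2)))
          (fun q => (g q.1, if g q.1 then q.2 else (0 : Fin L → ZMod 2)))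
          (g q.1, if g q.1 then q.2 else (0 : Fin L → ZMod 2))).card) =
      if g q.1 then
        Real.logb 2 (((Fintype.card α : ℝ) * 2 ^ L) / (univ.filter fun x' : α => g x' = true).card)
      else
        Real.logb 2 (((Fintype.card α : ℝ) * 2 ^ L) /
          ((univ.filter fun x' : α => g x' = false).card * 2 ^ L)) := by
  have hcard : (((univ : Finset (α × (Fin L → ZMod 2))).card : ℕ) : ℝ) = (Fintype.card α : ℝ) * 2 ^ L := by
    rw [Finset.card_univ, Fintype.card_prod, Fintype.card_pi, Finset.prod_const, ZMod.card,
      Finset.card_univ, Fintype.card_fin]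
    push_cast
    ring
  rw [hcard]
  obtain ⟨x, y⟩ := q
  cases hgx : g x
  · simp only [Bool.false_eq_true, if_false]
    rw [card_fiber_joint_false g L]
    push_cast
    ring_nf
  · simp only [if_true]
    rw [card_fiber_joint_true g L y]

/-- The accepted part of the product sample space has `#{g = 1} · 2^L` points. -/
theorem card_filter_fst_true :
    ((univ : Finset (α × (Fin L → ZMod 2))).filter fun q => g q.1 = true).card =
      (univ.filter fun x : α => g x = true).card * 2 ^ L := by
  have : ((univ : Finset (α × (Fin L → ZMod 2))).filter fun q => g q.1 = true) =
      (univ.filter fun x : α => g x = true) ×ˢ (univ : Finset (Fin L → ZMod 2)) := by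
    ext ⟨x, y⟩
    simp
  rw [this, Finset.card_product, Finset.card_univ, Fintype.card_pi, Finset.prod_const, ZMod.card,
    Finset.card_univ, Fintype.card_fin]

/-- The rejected part has `#{g = 0} · 2^L` points. -/
theorem card_filter_fst_false :
    ((univ : Finset (α × (Fin L → ZMod 2))).filter fun q => ¬ g q.1 = true).card =
      (univ.filter fun x : α => g x = false).card * 2 ^ L := by
  have : ((univ : Finset (α × (Fin L → ZMod 2))).filter fun q => ¬ g q.1 = true) =
      (univ.filter fun x : α => g x = false) ×ˢ (univ : Finset (Fin L → ZMod 2)) := by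
    ext ⟨x, y⟩
    simp
  rw [this, Finset.card_product, Finset.card_univ, Fintype.card_pi, Finset.prod_const, ZMod.card,
    Finset.card_univ, Fintype.card_fin]

/-- **The joint map `(x,y) ↦ (g x, Z(x,y))` has entropy `H = p · log₂((N·2^L)/c)·… ` — closed form as a
two-term sum** (`c = #{g = 1}`, `N = |α|`). -/
theorem mapEntropy_joint_eq [Nonempty α] :
    mapEntropy (univ : Finset (α × (Fin L → ZMod 2)))
        (fun q => (g q.1, if g q.1 then q.2 else (0 : Fin L → ZMod 2))) =
      (((univ.filter fun x : α => g x = true).card : ℝ) / Fintype.card α) *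
          Real.logb 2 (((Fintype.card α : ℝ) * 2 ^ L) / (univ.filter fun x' : α => g x' = true).card) +
        (((univ.filter fun x : α => g x = false).card : ℝ) / Fintype.card α) *
          Real.logb 2 (((Fintype.card α : ℝ) * 2 ^ L) /
            ((univ.filter fun x' : α => g x' = false).card * 2 ^ L)) := by
  have hNpos : (0 : ℝ) < Fintype.card α := by exact_mod_cast Fintype.card_pos
  have hcard : (((univ : Finset (α × (Fin L → ZMod 2))).card : ℕ) : ℝ) = (Fintype.card α : ℝ) * 2 ^ L := by
    rw [Finset.card_univ, Fintype.card_prod, Fintype.card_pi, Finset.prod_const, ZMod.card,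
      Finset.card_univ, Fintype.card_fin]
    push_cast
    ring
  unfold mapEntropy
  rw [Finset.sum_congr rfl (fun q _ => logb_fiber_joint g L q), Finset.sum_ite, Finset.sum_const,
    Finset.sum_const, card_filter_fst_true, card_filter_fst_false, hcard, nsmul_eq_mul, nsmul_eq_mul]
  have h2 : (0 : ℝ) < 2 ^ L := by positivity
  field_simp
  push_cast
  ring

/-- **Affine-in-`p` entropy bounds for the joint map**: `p · L ≤ H ≤ p · L + 1` where
`p = #{g = 1}/|α|` (the exact value is `h(p) + p·L`, `h` = binary entropy `≤ 1`).
[Cover–Thomas, 2nd ed., Thm 2.2.1 (chain rule) and (2.5) (`h ≤ 1`)] -/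
theorem mapEntropy_joint_bounds [Nonempty α] :
    (((univ.filter fun x : α => g x = true).card : ℝ) / Fintype.card α) * L ≤
        mapEntropy (univ : Finset (α × (Fin L → ZMod 2)))
          (fun q => (g q.1, if g q.1 then q.2 else (0 : Fin L → ZMod 2))) ∧
      mapEntropy (univ : Finset (α × (Fin L → ZMod 2)))
          (fun q => (g q.1, if g q.1 then q.2 else (0 : Fin L → ZMod 2))) ≤
        (((univ.filter fun x : α => g x = true).card : ℝ) / Fintype.card α) * L + 1 := by
  rw [mapEntropy_joint_eq]
  set c : ℕ := (univ.filter fun x : α => g x = true).card with hc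
  set N : ℕ := Fintype.card α with hN
  have hNpos : (0 : ℝ) < N := by rw [hN]; exact_mod_cast Fintype.card_pos
  have hcN : c ≤ N := by rw [hc, hN]; exact Finset.card_le_univ _
  have hcompl : (univ.filter fun x : α => g x = false).card = N - c := by
    have := Finset.card_filter_add_card_filter_not (s := (univ : Finset α)) (fun x => g x = true)
    simp only [Finset.card_univ, Bool.not_eq_true] at this
    omega
  rw [hcompl]
  have h2 : (0 : ℝ) < 2 ^ L := by positivity
  -- the probabilities
  set p : ℝ := (c : ℝ) / N with hp
  have hp0 : 0 ≤ p := by positivity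
  have hp1 : p ≤ 1 := by rw [hp, div_le_one hNpos]; exact_mod_cast hcN
  have hq : (((N - c : ℕ) : ℝ) / N) = 1 - p := by
    rw [hp, Nat.cast_sub hcN]
    field_simp
  rw [hq]
  -- case analysis on the boundary values of `c`
  rcases Nat.eq_zero_or_pos c with hc0 | hcpos
  · -- `p = 0`: the first term vanishes, the second is `log₂ 1 = 0`
    have hp00 : p = 0 := by rw [hp, hc0, Nat.cast_zero, zero_div]
    rw [hp00]
    have : ((N - c : ℕ) : ℝ) = N := by rw [hc0, Nat.sub_zero]
    simp only [zero_mul, zero_add, sub_zero, one_mul]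
    rw [this, div_self (by positivity), Real.logb_one]
    constructor <;> norm_num
  rcases (Nat.lt_or_ge c N) with hlt | hge
  · -- `0 < c < N`: the generic case, `H = p L + h(p)` with `0 ≤ h(p) ≤ 1`
    have hcpos' : (0 : ℝ) < c := by exact_mod_cast hcpos
    have hNc : (0 : ℝ) < ((N - c : ℕ) : ℝ) := by
      have : c < N := hlt
      exact_mod_cast Nat.sub_pos_of_lt this
    have hA : Real.logb 2 ((N : ℝ) * 2 ^ L / c) = L + Real.logb 2 p⁻¹ := by
      rw [hp, inv_div, show (N : ℝ) * 2 ^ L / c = 2 ^ L * ((N : ℝ) / c) by ring,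
        Real.logb_mul (by positivity) (by positivity), Real.logb_pow, Real.logb_self_eq_one (by norm_num)]
      ring
    have hB : Real.logb 2 ((N : ℝ) * 2 ^ L / (((N - c : ℕ) : ℝ) * 2 ^ L)) = Real.logb 2 (1 - p)⁻¹ := by
      rw [← hq, inv_div]
      congr 1
      field_simp
    rw [hA, hB]
    -- `h(p)` in bits
    have hbin : p * Real.logb 2 p⁻¹ + (1 - p) * Real.logb 2 (1 - p)⁻¹ = Real.binEntropy p / Real.log 2 := by
      unfold Real.logb Real.binEntropy
      ring
    have hlog2 : 0 < Real.log 2 := Real.log_pos (by norm_num)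
    have hh0 : 0 ≤ Real.binEntropy p / Real.log 2 := div_nonneg (Real.binEntropy_nonneg hp0 hp1) hlog2.le
    have hh1 : Real.binEntropy p / Real.log 2 ≤ 1 := by
      rw [div_le_one hlog2]; exact Real.binEntropy_le_log_two
    constructor <;> nlinarith [hbin, hh0, hh1]
  · -- `c = N`, `p = 1`: the second term vanishes, the first is `L`
    have hcN' : c = N := le_antisymm hcN hge
    have hp11 : p = 1 := by rw [hp, hcN', div_self hNpos.ne']
    rw [hp11, hcN', Nat.sub_self]
    simp only [sub_self, zero_mul, add_zero, one_mul, Nat.cast_zero]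
    rw [show (N : ℝ) * 2 ^ L / N = 2 ^ L by field_simp, Real.logb_pow,
      Real.logb_self_eq_one (by norm_num)]
    constructor <;> norm_num

/-- **The masked-uniform gadget: `p·L − 1 ≤ H(Z) ≤ p·L + 1`** for `Z(x, y) = if g x then y else 0`
(`p = P[g = 1]`): dropping the bit `g x` from the joint map costs at most one bit
(`mapEntropy_sub_le_mapEntropy_comp`), keeping it costs nothing (`mapEntropy_comp_le`).
[Cover–Thomas, 2nd ed., (2.14), Problem 2.4] -/
theorem mapEntropy_masked_bounds [Nonempty α] [DecidableEq α] :
    (((univ.filter fun x : α => g x = true).card : ℝ) / Fintype.card α) * L - 1 ≤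
        mapEntropy (univ : Finset (α × (Fin L → ZMod 2)))
          (fun q => if g q.1 then q.2 else (0 : Fin L → ZMod 2)) ∧
      mapEntropy (univ : Finset (α × (Fin L → ZMod 2)))
          (fun q => if g q.1 then q.2 else (0 : Fin L → ZMod 2)) ≤
        (((univ.filter fun x : α => g x = true).card : ℝ) / Fintype.card α) * L + 1 := by
  classical
  obtain ⟨hlo, hhi⟩ := mapEntropy_joint_bounds g L
  have hcomp : (fun q : α × (Fin L → ZMod 2) => if g q.1 then q.2 else (0 : Fin L → ZMod 2)) =
      Prod.snd ∘ (fun q => (g q.1, if g q.1 then q.2 else (0 : Fin L → ZMod 2))) := by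
    funext q; rfl
  constructor
  · -- losing the bit `g x` costs at most `1 = log₂ 2` bit
    have h := mapEntropy_sub_le_mapEntropy_comp (S := (univ : Finset (α × (Fin L → ZMod 2))))
      Finset.univ_nonempty (fun q => (g q.1, if g q.1 then q.2 else (0 : Fin L → ZMod 2))) Prod.snd 1
      (fun z => ?_)
    · rw [hcomp]
      push_cast at h
      linarith
    · -- at most the two points `(false, z)`, `(true, z)` of the image project to `z`
      calc (((univ : Finset (α × (Fin L → ZMod 2))).image
              (fun q => (g q.1, if g q.1 then q.2 else (0 : Fin L → ZMod 2)))).filter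
              fun y => y.2 = z).card
          ≤ (({false, true} : Finset Bool) ×ˢ ({z} : Finset (Fin L → ZMod 2))).card := by
            refine Finset.card_le_card fun y hy => ?_
            rw [Finset.mem_filter] at hy
            rw [Finset.mem_product, Finset.mem_singleton]
            refine ⟨?_, hy.2⟩
            cases y.1 <;> simp
        _ ≤ 2 ^ 1 := by rw [Finset.card_product]; simp
  · rw [hcomp]
    exact (mapEntropy_comp_le _ _ _).trans hhi

end Summit.PneNP.PneNP.Theorems.PeaThreeNotInP.Negative
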